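import Literature.Geometry.Manifold.MaximalIntegralCurve
import HarnessLib

/-!
# The flow of a complete vector field is a smooth global flow

General differential topology (Bröcker–Jänich 1982, (8.7)–(8.11); Lee 2012, Thm. 9.12), serving
the proof of Ehresmann's fibration theorem
(`Literature.AlgebraicTopology.Homotopy.ehresmann_fibration`, Bröcker–Jänich (8.12)), whose lifted
coordinate fields are complete by properness but live on a **non-compact** manifold. The tree has
the compact case (`Literature.Topology.FourManifolds.exists_contMDiff_globalFlow_holds`, where
completeness comes from a uniform time of existence and joint smoothness from iterating short-time
maps) and the local theory (`Literature.Geometry.Manifold.exists_localFlow`,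
`Literature.Geometry.Manifold.exists_maximal_integralCurve`). Here: on a Hausdorff `C^∞` manifold
all of whose points are interior (complete real model), for a `C^n` vector field `V`, `1 ≤ n`,

* `Literature.Geometry.Manifold.contMDiff_of_isMIntegralCurve_family` — if `θ x` is a global
  integral curve through `x` for **every** `x` (completeness, the curves chosen anyhow), then
  `(x, t) ↦ θ x t` is jointly `C^n` on `M × ℝ`. Proof (Bröcker–Jänich (8.11), the argument
  "`J_x` is open, non-empty and closed", PDF p. 56; Lee 2012, Thm. 9.12 (c)–(d)): for fixed `x₁`
  the set of times `t` near which `θ` is jointly `C^n` is open, contains `0` (near `(x₁, 0)` the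
  family agrees with a `C^n` local flow by uniqueness), and is closed: if `t*` is a limit of such
  times, a local flow about `θ x₁ t*` and the group law `θ x t = θ (θ x t₁) (t - t₁)` for a good
  time `t₁` close to `t*` exhibit `θ` as a composite of `C^n` maps near `(x₁, t*)`; `ℝ` is
  connected.
* `Literature.Geometry.Manifold.exists_contMDiff_globalFlow_of_complete` — hence a complete
  `C^n` field generates a `C^n` global flow `θ : ℝ × M → M` with `θ(0, p) = p`,
  `θ(t, θ(s, p)) = θ(t + s, p)`, whose curves are the integral curves (Lee 2012, Thm. 9.12 for
  complete fields; Bröcker–Jänich (8.10)–(8.11)).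
* `Literature.Geometry.Manifold.exists_uniform_time_of_isCompact` — on a compact **subset** there
  is a uniform time of existence of integral curves (finitely many local flows; Lee 2012, proof of
  Lemma 9.15 / Thm. 9.16).
* `Literature.Geometry.Manifold.exists_isMIntegralCurve_of_apriori_isCompact` — **a priori
  bounds give completeness**: if the integral curves through `x` of time at most `T` are confined
  to a compact set `K(x, T)`, then the integral curve through `x` exists for all times
  (Bröcker–Jänich, remark after (8.11), PDF p. 57: "a maximal solution curve which is not defined
  for all time eventually leaves each compact set"; Lee 2012, Lemma 9.19, escape lemma).
  Proof: the maximal integral curve (`exists_maximal_integralCurve`) extends by `ε(K)/2` past any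
  of its times at which it lies in `K`, so its open interval of definition is unbounded.

Everything is proved; no definitions (the statements are existential / about a given family).

## References

* Th. Bröcker, K. Jänich, *Introduction to Differential Topology*, CUP 1982, §8, (8.7)–(8.11) and
  the remark before (8.12) (held: `lit read book:brockernd-introduction-differential-topology`,
  PDF pp. 55–57). [BrockerJanichIDT1982]
* J. M. Lee, *Introduction to Smooth Manifolds*, 2nd ed., GTM 218 (2012), Thm. 9.12, Lemma 9.15,
  Thm. 9.16, Lemma 9.19. [LeeSmoothManifolds2013]
-/

open scoped Manifold ContDiff Topology
open Set Function Filter Metric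

noncomputable section

namespace Literature.Geometry.Manifold

universe u

section CompleteFlow

variable {E : Type u} [NormedAddCommGroup E] [NormedSpace ℝ E] [CompleteSpace E]
  {H : Type*} [TopologicalSpace H] {I : ModelWithCorners ℝ E H}
  {M : Type*} [TopologicalSpace M] [ChartedSpace H M] [IsManifold I ∞ M]
  [T2Space M] [BoundarylessManifold I M]
  {V : Π x : M, TangentSpace I x} {n : ℕ∞}

/-! ### Families of global integral curves: uniqueness and the group law -/

omit [CompleteSpace E] [IsManifold I ∞ M] in
/-- If `θ x` is a global integral curve through `x` for every `x`, every integral curve on an open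
interval about `0` is a restriction of the member of the family through its initial point
(uniqueness of integral curves, Lee 2012, Thm. 9.12 (a)). [cite: LeeSmoothManifolds2013, Thm. 9.12 (a)] -/
theorem eqOn_of_isMIntegralCurve_family [IsManifold I 1 M]
    (hV : ContMDiff I I.tangent 1 fun x => (⟨x, V x⟩ : TangentBundle I M))
    {θ : M → ℝ → M} (h0 : ∀ x, θ x 0 = x) (hθ : ∀ x, IsMIntegralCurve (θ x) V)
    {γ : ℝ → M} {a b : ℝ} (hab : (0 : ℝ) ∈ Ioo a b) (hγ : IsMIntegralCurveOn γ V (Ioo a b)) :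
    EqOn γ (θ (γ 0)) (Ioo a b) :=
  isMIntegralCurveOn_Ioo_eqOn_of_contMDiff_boundaryless hab hV hγ
    ((hθ _).isMIntegralCurveOn _) (by rw [h0])

omit [CompleteSpace E] [IsManifold I ∞ M] in
/-- If `θ x` is a global integral curve through `x` for every `x`, every global integral curve is
the member of the family through its initial point (Lee 2012, Thm. 9.12 (a)). [cite: LeeSmoothManifolds2013, Thm. 9.12 (a)] -/
theorem eq_of_isMIntegralCurve_family [IsManifold I 1 M]
    (hV : ContMDiff I I.tangent 1 fun x => (⟨x, V x⟩ : TangentBundle I M))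
    {θ : M → ℝ → M} (h0 : ∀ x, θ x 0 = x) (hθ : ∀ x, IsMIntegralCurve (θ x) V)
    {γ : ℝ → M} (hγ : IsMIntegralCurve γ V) : γ = θ (γ 0) :=
  isMIntegralCurve_Ioo_eq_of_contMDiff_boundaryless (t₀ := 0) hV hγ (hθ _) (by rw [h0])

omit [CompleteSpace E] [IsManifold I ∞ M] in
/-- **Group law** of a complete family of integral curves: `θ x (s + t) = θ (θ x s) t`
(Lee 2012, Thm. 9.12 (b); Bröcker–Jänich (8.7): the translate of an integral curve is the
integral curve through the translated initial point). [cite: LeeSmoothManifolds2013, Thm. 9.12 (b)] -/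
theorem isMIntegralCurve_family_add [IsManifold I 1 M]
    (hV : ContMDiff I I.tangent 1 fun x => (⟨x, V x⟩ : TangentBundle I M))
    {θ : M → ℝ → M} (h0 : ∀ x, θ x 0 = x) (hθ : ∀ x, IsMIntegralCurve (θ x) V)
    (x : M) (s t : ℝ) : θ x (s + t) = θ (θ x s) t := by
  have hγ : IsMIntegralCurve (fun t => θ x (t + s)) V := (hθ x).comp_add s
  have h := congrFun (eq_of_isMIntegralCurve_family hV h0 hθ hγ) t
  rw [add_comm s t]
  simpa only [zero_add] using h

omit [CompleteSpace E] [IsManifold I ∞ M] in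
/-- `θ (θ x t) (-t) = x` for a complete family of integral curves. [cite: LeeSmoothManifolds2013, Thm. 9.12 (b)] -/
theorem isMIntegralCurve_family_neg_apply [IsManifold I 1 M]
    (hV : ContMDiff I I.tangent 1 fun x => (⟨x, V x⟩ : TangentBundle I M))
    {θ : M → ℝ → M} (h0 : ∀ x, θ x 0 = x) (hθ : ∀ x, IsMIntegralCurve (θ x) V)
    (x : M) (t : ℝ) : θ (θ x t) (-t) = x := by
  rw [← isMIntegralCurve_family_add hV h0 hθ, add_neg_cancel, h0]

/-! ### Joint smoothness -/

/-- Near `t = 0` a complete family of integral curves of a `C^n` field (`1 ≤ n`) is jointly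
`C^n`: about every `x₀` there are an open `U ∋ x₀` and `ε > 0` with `(x, t) ↦ θ x t` of class
`C^n` on `U × (-ε, ε)` (it agrees there with a `C^n` local flow,
`Literature.Geometry.Manifold.exists_localFlow`, by uniqueness; Lee 2012, Thm. 9.12, proof). [cite: LeeSmoothManifolds2013, Thm. 9.12 (proof)] -/
theorem exists_contMDiffOn_of_isMIntegralCurve_family
    (hV : ContMDiff I I.tangent n fun x => (⟨x, V x⟩ : TangentBundle I M)) (hn : 1 ≤ n)
    {θ : M → ℝ → M} (h0 : ∀ x, θ x 0 = x) (hθ : ∀ x, IsMIntegralCurve (θ x) V) (x₀ : M) :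
    ∃ U : Set M, IsOpen U ∧ x₀ ∈ U ∧ ∃ ε > (0 : ℝ),
      ContMDiffOn (I.prod 𝓘(ℝ, ℝ)) I n (fun p : M × ℝ => θ p.1 p.2) (U ×ˢ Ioo (-ε) ε) := by
  have hV1 : ContMDiff I I.tangent 1 fun x => (⟨x, V x⟩ : TangentBundle I M) :=
    hV.of_le (by exact_mod_cast hn)
  obtain ⟨U, hUo, hx₀U, ε, hε, Φ, hΦ0, hΦc, hΦs⟩ :=
    exists_localFlow hV hn (BoundarylessManifold.isInteriorPoint (x := x₀))
  refine ⟨U, hUo, hx₀U, ε, hε, hΦs.congr ?_⟩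
  rintro ⟨x, t⟩ ⟨hx, ht⟩
  have h00 : (0 : ℝ) ∈ Ioo (-ε) ε := ⟨by linarith, hε⟩
  have h := eqOn_of_isMIntegralCurve_family hV1 h0 hθ h00 (hΦc x hx) ht
  simp only [hΦ0 x hx] at h
  exact h.symm

/-- **A complete family of integral curves is jointly smooth** (Bröcker–Jänich (8.11), proof:
"`J_x` is open … non-empty and closed", PDF p. 56; Lee 2012, Thm. 9.12 (c)–(d)): if `θ x` is a
global integral curve of the `C^n` field `V` (`1 ≤ n`) through `x` for every `x`, then
`(x, t) ↦ θ x t` is `C^n` on `M × ℝ`. For fixed `x₁`, the set `S` of times `t` such that `θ` is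
`C^n` on a neighbourhood of `(x₁, t)` is open, contains `0`
(`exists_contMDiffOn_of_isMIntegralCurve_family`), and is closed: for `t*` in its closure take a
local flow box `U × (-ε, ε)` about `θ x₁ t*`, a good time `t₁` with `|t₁ - t*| < ε / 2` and
`θ x₁ t₁ ∈ U`, and write `θ x t = θ (θ x t₁) (t - t₁)` near `(x₁, t*)`. [cite: BrockerJanichIDT1982, (8.11) (proof)] -/
theorem contMDiff_of_isMIntegralCurve_family
    (hV : ContMDiff I I.tangent n fun x => (⟨x, V x⟩ : TangentBundle I M)) (hn : 1 ≤ n)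
    {θ : M → ℝ → M} (h0 : ∀ x, θ x 0 = x) (hθ : ∀ x, IsMIntegralCurve (θ x) V) :
    ContMDiff (I.prod 𝓘(ℝ, ℝ)) I n (fun p : M × ℝ => θ p.1 p.2) := by
  have hV1 : ContMDiff I I.tangent 1 fun x => (⟨x, V x⟩ : TangentBundle I M) :=
    hV.of_le (by exact_mod_cast hn)
  set F : M × ℝ → M := fun p => θ p.1 p.2 with hF
  -- it suffices to find, about every point, an open set on which `F` is `C^n`
  suffices key : ∀ (x₁ : M) (t : ℝ), ∃ W : Set (M × ℝ), IsOpen W ∧ (x₁, t) ∈ W ∧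
      ContMDiffOn (I.prod 𝓘(ℝ, ℝ)) I n F W by
    rintro ⟨x₁, t⟩
    obtain ⟨W, hWo, hW, hFW⟩ := key x₁ t
    exact (hFW _ hW).contMDiffAt (hWo.mem_nhds hW)
  intro x₁
  set S : Set ℝ := {t | ∃ W : Set (M × ℝ), IsOpen W ∧ (x₁, t) ∈ W ∧
      ContMDiffOn (I.prod 𝓘(ℝ, ℝ)) I n F W} with hS
  suffices hSu : S = univ by
    intro t
    have ht : t ∈ S := by rw [hSu]; exact mem_univ t
    exact ht
  have hloc := fun x₀ => exists_contMDiffOn_of_isMIntegralCurve_family hV hn h0 hθ x₀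
  -- `S` is open
  have hSo : IsOpen S := by
    rw [isOpen_iff_mem_nhds]
    rintro t ⟨W, hWo, htW, hFW⟩
    have hmem : {s : ℝ | (x₁, s) ∈ W} ∈ 𝓝 t :=
      (hWo.preimage (continuous_const.prodMk continuous_id)).mem_nhds htW
    filter_upwards [hmem] with s hs
    exact ⟨W, hWo, hs, hFW⟩
  -- `0 ∈ S`
  have hS0 : (0 : ℝ) ∈ S := by
    obtain ⟨U, hUo, hx₁U, ε, hε, hsm⟩ := hloc x₁
    exact ⟨U ×ˢ Ioo (-ε) ε, hUo.prod isOpen_Ioo, ⟨hx₁U, ⟨by linarith, hε⟩⟩, hsm⟩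
  -- `S` is closed
  have hSc : IsClosed S := by
    apply isClosed_of_closure_subset
    intro tstar htstar
    obtain ⟨U, hUo, hpU, ε, hε, hsm⟩ := hloc (θ x₁ tstar)
    -- the orbit of `x₁` stays in `U` for times near `tstar`
    have hcont : ContinuousAt (θ x₁) tstar := (hθ x₁).continuous.continuousAt
    obtain ⟨δ, hδ, hδU⟩ : ∃ δ > (0 : ℝ), ∀ s, dist s tstar < δ → θ x₁ s ∈ U := by
      have hpre : (θ x₁) ⁻¹' U ∈ 𝓝 tstar := hcont.preimage_mem_nhds (hUo.mem_nhds hpU)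
      obtain ⟨δ, hδ, hball⟩ := Metric.mem_nhds_iff.1 hpre
      exact ⟨δ, hδ, fun s hs => hball hs⟩
    -- a good time `t₁` close to `tstar`
    obtain ⟨t₁, ht₁S, ht₁⟩ :=
      Metric.mem_closure_iff.1 htstar (min δ (ε / 2)) (lt_min hδ (half_pos hε))
    obtain ⟨W₁, hW₁o, hW₁, hFW₁⟩ := ht₁S
    have hd1 : dist t₁ tstar < δ := by
      rw [dist_comm]; exact lt_of_lt_of_le ht₁ (min_le_left _ _)
    have hd2 : |tstar - t₁| < ε / 2 := by
      rw [← Real.dist_eq]; exact lt_of_lt_of_le ht₁ (min_le_right _ _)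
    -- `x ↦ θ x t₁` is `C^n` near `x₁`
    set V₁ : Set M := {x | (x, t₁) ∈ W₁} with hV₁
    have hV₁o : IsOpen V₁ := hW₁o.preimage (continuous_id.prodMk continuous_const)
    have hx₁V₁ : x₁ ∈ V₁ := hW₁
    have hG : ContMDiffOn I I n (fun x => θ x t₁) V₁ :=
      hFW₁.comp (contMDiffOn_id.prodMk contMDiffOn_const) fun x hx => hx
    have hGc : ContinuousOn (fun x => θ x t₁) V₁ := hG.continuousOn
    -- the neighbourhood of `(x₁, tstar)` on which `θ x t = θ (θ x t₁) (t - t₁)` is a `C^n` composite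
    set W : Set (M × ℝ) := (V₁ ∩ (fun x => θ x t₁) ⁻¹' U) ×ˢ Ioo (t₁ - ε) (t₁ + ε) with hW
    have hWo : IsOpen W := (hGc.isOpen_inter_preimage hV₁o hUo).prod isOpen_Ioo
    have hmemW : (x₁, tstar) ∈ W := by
      refine ⟨⟨hx₁V₁, ?_⟩, ?_⟩
      · exact hδU t₁ hd1
      · rw [abs_lt] at hd2
        constructor <;> linarith
    refine ⟨W, hWo, hmemW, ?_⟩
    have hinner : ContMDiffOn (I.prod 𝓘(ℝ, ℝ)) (I.prod 𝓘(ℝ, ℝ)) n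
        (fun q : M × ℝ => (θ q.1 t₁, q.2 - t₁)) W := by
      refine ContMDiffOn.prodMk ?_ ?_
      · exact hG.comp contMDiffOn_fst fun q hq => hq.1.1
      · exact (contDiff_id.sub contDiff_const).contMDiff.comp_contMDiffOn contMDiffOn_snd
    have hcomp := hsm.comp hinner fun q hq => by
      obtain ⟨⟨-, hq1⟩, hq2, hq3⟩ := hq
      exact ⟨hq1, ⟨by linarith, by linarith⟩⟩
    refine hcomp.congr fun q _ => ?_
    show θ q.1 q.2 = θ (θ q.1 t₁) (q.2 - t₁)
    rw [← isMIntegralCurve_family_add hV1 h0 hθ, add_sub_cancel]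
  have hclopen : IsClopen S := ⟨hSc, hSo⟩
  exact hclopen.eq_univ ⟨0, hS0⟩

/-- **The fundamental theorem on flows for complete vector fields** (Lee 2012, Thm. 9.12 for a
complete field, completeness meaning (p. 215) that every maximal integral curve is defined on
`ℝ`; Bröcker–Jänich (8.10)–(8.11)): on a Hausdorff `C^∞` manifold without boundary points over a
complete real model, a `C^n` vector field (`1 ≤ n`) through every point of which there passes an
integral curve defined on all of `ℝ` generates a **global flow** `θ : ℝ × M → M`, jointly `C^n`,
with `θ(0, p) = p` and `θ(t, θ(s, p)) = θ(t + s, p)`, whose curves `t ↦ θ(t, p)` are the integral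
curves of `V`. [cite: LeeSmoothManifolds2013, Thm. 9.12] -/
theorem exists_contMDiff_globalFlow_of_complete
    (hV : ContMDiff I I.tangent n fun x => (⟨x, V x⟩ : TangentBundle I M)) (hn : 1 ≤ n)
    (hc : ∀ x : M, ∃ γ : ℝ → M, γ 0 = x ∧ IsMIntegralCurve γ V) :
    ∃ θ : ℝ × M → M, ContMDiff (𝓘(ℝ, ℝ).prod I) I n θ ∧ (∀ p, θ (0, p) = p) ∧
      (∀ t s p, θ (t, θ (s, p)) = θ (t + s, p)) ∧
      ∀ p, IsMIntegralCurve (fun t => θ (t, p)) V := by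
  have hV1 : ContMDiff I I.tangent 1 fun x => (⟨x, V x⟩ : TangentBundle I M) :=
    hV.of_le (by exact_mod_cast hn)
  choose φ h0 hφ using hc
  refine ⟨fun p => φ p.2 p.1, ?_, fun p => h0 p, fun t s p => ?_, fun p => hφ p⟩
  · exact (contMDiff_of_isMIntegralCurve_family hV hn h0 hφ).comp
      (contMDiff_snd.prodMk contMDiff_fst)
  · show φ (φ p s) t = φ p (t + s)
    rw [← isMIntegralCurve_family_add hV1 h0 hφ, add_comm]

/-! ### Completeness from a priori bounds -/

omit [T2Space M] [BoundarylessManifold I M] in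
/-- **Uniform time of existence on a compact set** (Lee 2012, proof of Lemma 9.15 / Thm. 9.16):
for a `C^n` field (`1 ≤ n`) on a manifold all of whose points of a compact set `K` are interior
— here: all points interior — there is `ε > 0` such that through every point of `K` there is
an integral curve defined on `(-ε, ε)` (finitely many of the local flows of
`Literature.Geometry.Manifold.exists_localFlow` cover `K`). [cite: LeeSmoothManifolds2013, Lemma 9.15 and Thm. 9.16 (proof)] -/
theorem exists_uniform_time_of_isCompact [BoundarylessManifold I M]
    (hV : ContMDiff I I.tangent n fun x => (⟨x, V x⟩ : TangentBundle I M)) (hn : 1 ≤ n)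
    {K : Set M} (hK : IsCompact K) :
    ∃ ε > (0 : ℝ), ∀ x ∈ K, ∃ γ : ℝ → M, γ 0 = x ∧ IsMIntegralCurveOn γ V (Ioo (-ε) ε) := by
  classical
  have hloc : ∀ x₀ : M, ∃ U : Set M, IsOpen U ∧ x₀ ∈ U ∧ ∃ ε > (0 : ℝ), ∃ Φ : M → ℝ → M,
      (∀ x ∈ U, Φ x 0 = x) ∧ (∀ x ∈ U, IsMIntegralCurveOn (Φ x) V (Ioo (-ε) ε)) ∧
      ContMDiffOn (I.prod 𝓘(ℝ, ℝ)) I n (fun p : M × ℝ => Φ p.1 p.2) (U ×ˢ Ioo (-ε) ε) :=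
    fun x₀ => exists_localFlow hV hn BoundarylessManifold.isInteriorPoint
  choose U hUo hxU ε hε Φ hΦ0 hΦc _hΦs using hloc
  obtain ⟨T, hT⟩ := hK.elim_finite_subcover U hUo fun x hx => mem_iUnion.2 ⟨x, hxU x⟩
  rcases T.eq_empty_or_nonempty with hTe | hTne
  · refine ⟨1, one_pos, fun x hx => ?_⟩
    have := hT hx
    rw [hTe] at this
    simp at this
  refine ⟨T.inf' hTne ε, (Finset.lt_inf'_iff hTne).2 fun i _ => hε i, fun x hx => ?_⟩
  obtain ⟨i, hi, hxi⟩ := mem_iUnion₂.1 (hT hx)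
  have hIoo : Ioo (-(T.inf' hTne ε)) (T.inf' hTne ε) ⊆ Ioo (-ε i) (ε i) := fun t ht =>
    ⟨lt_of_le_of_lt (neg_le_neg (Finset.inf'_le _ hi)) ht.1,
      lt_of_lt_of_le ht.2 (Finset.inf'_le _ hi)⟩
  exact ⟨Φ i x, hΦ0 i x hxi, (hΦc i x hxi).mono hIoo⟩

/-- **A priori bounds give completeness** (Bröcker–Jänich, remark after (8.11), PDF p. 57: "a
maximal solution curve which is not defined for all time eventually leaves each compact set";
Lee 2012, Lemma 9.19): let `V` be a `C^n` field (`1 ≤ n`) on a Hausdorff manifold without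
boundary points, and suppose that for every `x` and every `T` there is a compact set `K`
containing `γ t` whenever `γ` is an integral curve of `V` through `γ 0 = x` on an open interval
`J ∋ 0`, `t ∈ J` and `|t| ≤ T`. Then through every point there is an integral curve of `V`
defined on all of `ℝ`. Proof: the maximal integral curve through `x`
(`Literature.Geometry.Manifold.exists_maximal_integralCurve`) extends by a fixed time past each of
its times at which it lies in `K` (`exists_uniform_time_of_isCompact` and maximality), so its
interval of definition is unbounded above and below. [cite: BrockerJanichIDT1982, (8.11) and the remark following it] -/
theorem exists_isMIntegralCurve_of_apriori_isCompact
    (hV : ContMDiff I I.tangent n fun x => (⟨x, V x⟩ : TangentBundle I M)) (hn : 1 ≤ n)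
    (hb : ∀ (x : M) (T : ℝ), ∃ K : Set M, IsCompact K ∧
      ∀ (γ : ℝ → M) (J : Set ℝ), IsOpen J → J.OrdConnected → (0 : ℝ) ∈ J → γ 0 = x →
        IsMIntegralCurveOn γ V J → ∀ t ∈ J, |t| ≤ T → γ t ∈ K)
    (x : M) : ∃ γ : ℝ → M, γ 0 = x ∧ IsMIntegralCurve γ V := by
  have hV1 : ContMDiff I I.tangent 1 fun x => (⟨x, V x⟩ : TangentBundle I M) :=
    hV.of_le (by exact_mod_cast hn)
  obtain ⟨θ, D, hDo, hDc, h0D, hθ0, hθ, hmax⟩ := exists_maximal_integralCurve (I := I) hV1 x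
  -- extension past any time of `D` at which `θ` lies in a compact set
  have hext : ∀ K : Set M, IsCompact K → ∃ ε > (0 : ℝ), ε ≤ 1 ∧ ∀ t₁ ∈ D, θ t₁ ∈ K →
      Ioo (t₁ - ε) (t₁ + ε) ⊆ D := by
    intro K hK
    obtain ⟨ε, hε, hunif⟩ := exists_uniform_time_of_isCompact hV hn hK
    refine ⟨min ε 1, lt_min hε one_pos, min_le_right _ _, fun t₁ ht₁ hθt₁ => ?_⟩
    obtain ⟨γ₁, hγ₁0, hγ₁⟩ := hunif (θ t₁) hθt₁
    have hγ₂ : IsMIntegralCurveOn (γ₁ ∘ (· - t₁)) V {t | t - t₁ ∈ Ioo (-ε) ε} :=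
      isMIntegralCurveOn_comp_sub.2 hγ₁
    have hJ : {t : ℝ | t - t₁ ∈ Ioo (-ε) ε} = Ioo (t₁ - ε) (t₁ + ε) := by
      ext t; constructor
      · rintro ⟨h1, h2⟩; exact ⟨by linarith, by linarith⟩
      · rintro ⟨h1, h2⟩; exact ⟨by linarith, by linarith⟩
    rw [hJ] at hγ₂
    have hsub := (hmax (γ₁ ∘ (· - t₁)) (Ioo (t₁ - ε) (t₁ + ε)) isOpen_Ioo ordConnected_Ioo t₁
      ⟨by linarith, by linarith⟩ ht₁ (by simp [hγ₁0]) hγ₂).1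
    exact (Ioo_subset_Ioo (by linarith [min_le_left ε 1]) (by linarith [min_le_left ε 1])).trans
      hsub
  -- the a priori bound for `θ` itself
  have hθK : ∀ T : ℝ, ∃ K : Set M, IsCompact K ∧ ∀ t ∈ D, |t| ≤ T → θ t ∈ K := by
    intro T
    obtain ⟨K, hK, hKγ⟩ := hb x T
    exact ⟨K, hK, fun t ht hT => hKγ θ D hDo hDc h0D hθ0 hθ t ht hT⟩
  -- `D` is unbounded above
  have hup : ¬BddAbove D := by
    intro hbdd
    set T := sSup D with hT
    have hT0 : 0 ≤ T := le_csSup hbdd h0D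
    obtain ⟨K, hK, hKθ⟩ := hθK (T + 1)
    obtain ⟨ε, hε, hε1, hKext⟩ := hext K hK
    obtain ⟨t₁, ht₁D, ht₁⟩ := exists_lt_of_lt_csSup ⟨0, h0D⟩ (show T - ε / 2 < sSup D by linarith)
    have ht₁T : t₁ ≤ T := le_csSup hbdd ht₁D
    have hθt₁ : θ t₁ ∈ K := hKθ t₁ ht₁D (by rw [abs_le]; constructor <;> linarith)
    have hmem : t₁ + ε / 2 ∈ D := hKext t₁ ht₁D hθt₁ ⟨by linarith, by linarith⟩
    have := le_csSup hbdd hmem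
    linarith
  -- `D` is unbounded below
  have hdown : ¬BddBelow D := by
    intro hbdd
    set T := sInf D with hT
    have hT0 : T ≤ 0 := csInf_le hbdd h0D
    obtain ⟨K, hK, hKθ⟩ := hθK (-T + 1)
    obtain ⟨ε, hε, hε1, hKext⟩ := hext K hK
    obtain ⟨t₁, ht₁D, ht₁⟩ := exists_lt_of_csInf_lt ⟨0, h0D⟩ (show sInf D < T + ε / 2 by linarith)
    have ht₁T : T ≤ t₁ := csInf_le hbdd ht₁D
    have hθt₁ : θ t₁ ∈ K := hKθ t₁ ht₁D (by rw [abs_le]; constructor <;> linarith)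
    have hmem : t₁ - ε / 2 ∈ D := hKext t₁ ht₁D hθt₁ ⟨by linarith, by linarith⟩
    have := csInf_le hbdd hmem
    linarith
  -- hence `D = ℝ`
  have hD : D = univ := by
    refine eq_univ_of_forall fun t => ?_
    obtain ⟨d₂, hd₂, htd₂⟩ := not_bddAbove_iff.1 hup t
    obtain ⟨d₁, hd₁, htd₁⟩ := not_bddBelow_iff.1 hdown t
    exact hDc.out hd₁ hd₂ ⟨htd₁.le, htd₂.le⟩
  refine ⟨θ, hθ0, isMIntegralCurve_iff_isMIntegralCurveOn.2 ?_⟩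
  rw [← hD]
  exact hθ

end CompleteFlow

end Literature.Geometry.Manifold
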